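import Summits.HodgeConjecture.CorCM.IrreducibleOddWeightsIsotypicMultiplicityCMFields
import HarnessLib

/-!
# Isotypic cells, XV: THE CLASS DEFECT IS `dim(⟨b⟩ ∩ ⟨b′⟩) · dim A` — inside an absolutely irreducible class the two
# shadow-coefficient spaces meet in as many copies of `A` as the ℚ-SPANS OF THE TWO COMPONENT TUPLES meet in the
# reference module; ADDITIVITY iff `⟨b⟩ ∩ ⟨b′⟩ = 0`

COR-CM (cell `pub-hodgecm2`, binder seat `b16` gen 70, count-neutral claim ISOTYPIC SPLITTING OF THE DEFECT, file I15 —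
abstract `G`-set level, type ranks and CM fields; theorems only, no definition, no named fact, no `sorry`).  NEW as
stated, hence under `Summits/`.  HONEST FRAMING: file I9/I10's relation count `(rank b + rank b′ − rank(b ⊔ b′))·dim A`
read through Grassmann's identity `dim(U + U′) + dim(U ∩ U′) = dim U + dim U′`; linear algebra of odd weights with
consequences for `dim MT(A₀ × A₁)` (Kubota–Dodson rank = `dim MT`, Pohlmann); nothing about Hodge classes is asserted;
`HC_CM` is neither used nor asserted.

SETTING (as in I9/I10).  A reference stable irreducible `A ≤ ℚ^{Y}` with SCALAR COMMUTANT; jointly independent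
equivariant embeddings `ι_j : ℚ^{Y} → ℚ^{Y₀}` (`j ∈ J₀`), `ι′_k : ℚ^{Y} → ℚ^{Y₁}` (`k ∈ J₁`); shadows
`w₀ = Σ_j ι_j(b_j)`, `w₁ = Σ_k ι′_k(b′_k)` with `b_j, b′_k ∈ A`; `⟨b⟩ = span_ℚ{b_j}`, `⟨b′⟩ = span_ℚ{b′_k} ≤ A`.

* **`finrank_span_shadowCoeff_inf_eq_finrank_inf_mul`**: **`dim(S(w₀) ∩ S(w₁)) = dim(⟨b⟩ ∩ ⟨b′⟩) · dim A`**.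
* **`span_shadowCoeff_inf_eq_bot_iff_of_class`** (`A ≠ 0`): **`S(w₀) ∩ S(w₁) = 0 ⟺ ⟨b⟩ ∩ ⟨b′⟩ = 0`**.
* type ranks `typeRank_add_typeRank_eq_add_finrank_inf_mul_of_class`, `typeRank_add_typeRank_eq_iff_of_class`; CM
  fields **`cmTypeRank_add_cmTypeRank_eq_add_finrank_inf_mul_of_class`**:
  **`dim Hg(A₀)+dim Hg(A₁)−dim Hg(A₀×A₁) = dim(⟨b⟩ ∩ ⟨b′⟩) · dim A`**, and
  **`cmTypeRank_add_cmTypeRank_eq_iff_of_class`**: `Hg(A₀×A₁) = Hg(A₀)×Hg(A₁)` IFF the ℚ-spans of the two component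
  tuples meet trivially in the reference module.
  One component per side: `⟨b⟩ ∩ ⟨b′⟩ = ℚb` or `0` (gen 69 Q3/Q4); a lone component against many: file I14.

## References

* [Gordon1999HodgeAVSurvey] B. B. Gordon, *A survey of the Hodge conjecture for abelian varieties*, §3 Theorem (Imai,
  Murty) with proof, 7.5–7.7, 9.4.3.
* [Lang2002] S. Lang, *Algebra*, 3rd ed., XVII §3.
* [Serre1977] J.-P. Serre, *Linear Representations of Finite Groups*, GTM 42, §2.6.
-/

set_option autoImplicit false

noncomputable section

open scoped BigOperators Classical

universe u u₀ u₁ v v' v'' vY w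

namespace Summit.HodgeConjecture.CorCM.IrrOdd

open Literature.NumberTheory.ComplexMultiplication

/-! ### §1 Grassmann bookkeeping -/

section Rank

variable {V : Type v} [AddCommGroup V] [Module ℚ V] [FiniteDimensional ℚ V]

/-- `rank(b ⊔ b′) + dim(⟨b⟩ ∩ ⟨b′⟩) = rank b + rank b′` (Grassmann). [folklore] -/
theorem finrank_span_range_sum_elim_add_finrank_inf {J₀ : Type u₀} {J₁ : Type u₁} (b₀ : J₀ → V) (b₁ : J₁ → V) :
    Module.finrank ℚ ↥(Submodule.span ℚ (Set.range (Sum.elim b₀ b₁))) +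
        Module.finrank ℚ ↥(Submodule.span ℚ (Set.range b₀) ⊓ Submodule.span ℚ (Set.range b₁)) =
      Module.finrank ℚ ↥(Submodule.span ℚ (Set.range b₀)) + Module.finrank ℚ ↥(Submodule.span ℚ (Set.range b₁)) := by
  rw [Set.Sum.elim_range, Submodule.span_union]
  exact Submodule.finrank_sup_add_finrank_inf_eq _ _

end Rank

/-! ### §2 The class defect is `dim(⟨b⟩ ∩ ⟨b′⟩) · dim A` -/

variable {G : Type w} [Group G] {Y : Type vY} [MulAction G Y] [Fintype Y]
  {Y₀ : Type v'} [MulAction G Y₀] [Fintype Y₀] {Y₁ : Type v''} [MulAction G Y₁] [Fintype Y₁]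

/-- **THE CLASS DEFECT IS `dim(⟨b⟩ ∩ ⟨b′⟩) · dim A`.**  `A` stable irreducible with scalar commutant; `ι_j`, `ι′_k`
equivariant on `A`, each family jointly independent on `A`; `b_j, b′_k ∈ A`.  Then
`dim(S(Σ_j ι_j b_j) ∩ S(Σ_k ι′_k b′_k)) = dim(span{b_j} ∩ span{b′_k}) · dim A`. [cite: Lang2002, XVII §3]
[cite: Serre1977, §2.6] [cite: Gordon1999HodgeAVSurvey, §3 Theorem (proof), 7.5–7.7] -/
theorem finrank_span_shadowCoeff_inf_eq_finrank_inf_mul {A : Submodule ℚ (Y → ℚ)}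
    (hAst : ∀ (k : G) (a : Y → ℚ), a ∈ A → (fun y => a (k • y)) ∈ A)
    (hAirr : ∀ W : Submodule ℚ (Y → ℚ), W ≤ A → W ≠ ⊥ →
      (∀ (k : G) (f : Y → ℚ), f ∈ W → (fun y => f (k • y)) ∈ W) → W = A)
    (hsc : ∀ L : (Y → ℚ) →ₗ[ℚ] (Y → ℚ), (∀ a ∈ A, L a ∈ A) →
      (∀ (k : G) (a : Y → ℚ), a ∈ A → L (fun y => a (k • y)) = fun y => L a (k • y)) → ∃ c : ℚ, ∀ a ∈ A, L a = c • a)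
    {J₀ : Type u₀} {J₁ : Type u₁} [Fintype J₀] [Fintype J₁]
    (ι₀ : J₀ → ((Y → ℚ) →ₗ[ℚ] (Y₀ → ℚ))) (ι₁ : J₁ → ((Y → ℚ) →ₗ[ℚ] (Y₁ → ℚ)))
    (hι₀eq : ∀ (j : J₀) (k : G) (a : Y → ℚ), a ∈ A → ι₀ j (fun y => a (k • y)) = fun y => ι₀ j a (k • y))
    (hι₁eq : ∀ (j : J₁) (k : G) (a : Y → ℚ), a ∈ A → ι₁ j (fun y => a (k • y)) = fun y => ι₁ j a (k • y))
    (hind₀ : ∀ f : J₀ → (Y → ℚ), (∀ j, f j ∈ A) → ∑ j, ι₀ j (f j) = 0 → ∀ j, f j = 0)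
    (hind₁ : ∀ f : J₁ → (Y → ℚ), (∀ j, f j ∈ A) → ∑ j, ι₁ j (f j) = 0 → ∀ j, f j = 0)
    {b₀ : J₀ → (Y → ℚ)} {b₁ : J₁ → (Y → ℚ)} (hb₀ : ∀ j, b₀ j ∈ A) (hb₁ : ∀ j, b₁ j ∈ A) :
    Module.finrank ℚ ↥(Submodule.span ℚ (Set.range fun y : Y₀ => fun g : G => (∑ j, ι₀ j (b₀ j)) (g • y)) ⊓
        Submodule.span ℚ (Set.range fun y : Y₁ => fun g : G => (∑ j, ι₁ j (b₁ j)) (g • y))) =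
      Module.finrank ℚ ↥(Submodule.span ℚ (Set.range b₀) ⊓ Submodule.span ℚ (Set.range b₁)) *
        Module.finrank ℚ A := by
  have hcls := finrank_span_shadowCoeff_inf_add_rank_mul_eq hAst hAirr hsc ι₀ ι₁ hι₀eq hι₁eq hind₀ hind₁ hb₀ hb₁
  have hgr := finrank_span_range_sum_elim_add_finrank_inf b₀ b₁
  have hmul : (Module.finrank ℚ ↥(Submodule.span ℚ (Set.range b₀)) +
      Module.finrank ℚ ↥(Submodule.span ℚ (Set.range b₁))) * Module.finrank ℚ A =
      Module.finrank ℚ ↥(Submodule.span ℚ (Set.range (Sum.elim b₀ b₁))) * Module.finrank ℚ A +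
        Module.finrank ℚ ↥(Submodule.span ℚ (Set.range b₀) ⊓ Submodule.span ℚ (Set.range b₁)) *
          Module.finrank ℚ A := by
    rw [← hgr, add_mul]
  omega

/-- **ADDITIVITY INSIDE A CLASS ⟺ THE SPANS OF THE COMPONENT TUPLES MEET TRIVIALLY**: for `A ≠ 0`,
`S(w₀) ∩ S(w₁) = 0 ⟺ span{b_j} ∩ span{b′_k} = 0`. [cite: Lang2002, XVII §3] [cite: Serre1977, §2.6] -/
theorem span_shadowCoeff_inf_eq_bot_iff_of_class {A : Submodule ℚ (Y → ℚ)}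
    (hAst : ∀ (k : G) (a : Y → ℚ), a ∈ A → (fun y => a (k • y)) ∈ A)
    (hAirr : ∀ W : Submodule ℚ (Y → ℚ), W ≤ A → W ≠ ⊥ →
      (∀ (k : G) (f : Y → ℚ), f ∈ W → (fun y => f (k • y)) ∈ W) → W = A)
    (hsc : ∀ L : (Y → ℚ) →ₗ[ℚ] (Y → ℚ), (∀ a ∈ A, L a ∈ A) →
      (∀ (k : G) (a : Y → ℚ), a ∈ A → L (fun y => a (k • y)) = fun y => L a (k • y)) → ∃ c : ℚ, ∀ a ∈ A, L a = c • a)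
    (hA0 : A ≠ ⊥) {J₀ : Type u₀} {J₁ : Type u₁} [Fintype J₀] [Fintype J₁]
    (ι₀ : J₀ → ((Y → ℚ) →ₗ[ℚ] (Y₀ → ℚ))) (ι₁ : J₁ → ((Y → ℚ) →ₗ[ℚ] (Y₁ → ℚ)))
    (hι₀eq : ∀ (j : J₀) (k : G) (a : Y → ℚ), a ∈ A → ι₀ j (fun y => a (k • y)) = fun y => ι₀ j a (k • y))
    (hι₁eq : ∀ (j : J₁) (k : G) (a : Y → ℚ), a ∈ A → ι₁ j (fun y => a (k • y)) = fun y => ι₁ j a (k • y))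
    (hind₀ : ∀ f : J₀ → (Y → ℚ), (∀ j, f j ∈ A) → ∑ j, ι₀ j (f j) = 0 → ∀ j, f j = 0)
    (hind₁ : ∀ f : J₁ → (Y → ℚ), (∀ j, f j ∈ A) → ∑ j, ι₁ j (f j) = 0 → ∀ j, f j = 0)
    {b₀ : J₀ → (Y → ℚ)} {b₁ : J₁ → (Y → ℚ)} (hb₀ : ∀ j, b₀ j ∈ A) (hb₁ : ∀ j, b₁ j ∈ A) :
    Submodule.span ℚ (Set.range fun y : Y₀ => fun g : G => (∑ j, ι₀ j (b₀ j)) (g • y)) ⊓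
        Submodule.span ℚ (Set.range fun y : Y₁ => fun g : G => (∑ j, ι₁ j (b₁ j)) (g • y)) = ⊥ ↔
      Submodule.span ℚ (Set.range b₀) ⊓ Submodule.span ℚ (Set.range b₁) = ⊥ := by
  have h := finrank_span_shadowCoeff_inf_eq_finrank_inf_mul hAst hAirr hsc ι₀ ι₁ hι₀eq hι₁eq hind₀ hind₁ hb₀ hb₁
  haveI : FiniteDimensional ℚ A := Submodule.finiteDimensional_of_le le_top
  haveI : FiniteDimensional ℚ ↥(Submodule.span ℚ (Set.range fun y : Y₀ => fun g : G => (∑ j, ι₀ j (b₀ j)) (g • y))) :=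
    FiniteDimensional.span_of_finite ℚ (Set.finite_range _)
  haveI : FiniteDimensional ℚ ↥(Submodule.span ℚ (Set.range fun y : Y₀ => fun g : G => (∑ j, ι₀ j (b₀ j)) (g • y)) ⊓
      Submodule.span ℚ (Set.range fun y : Y₁ => fun g : G => (∑ j, ι₁ j (b₁ j)) (g • y))) :=
    Submodule.finiteDimensional_of_le inf_le_left
  have hA : Module.finrank ℚ A ≠ 0 := fun h0 => hA0 (Submodule.finrank_eq_zero.1 h0)
  rw [← Submodule.finrank_eq_zero, ← Submodule.finrank_eq_zero, h]
  constructor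
  · intro h0
    rcases mul_eq_zero.1 h0 with h1 | h1
    · exact h1
    · exact absurd h1 hA
  · intro h0
    rw [h0, zero_mul]

/-! ### §3 Type ranks -/

section TypeRanks

variable {I : Type u} {E : I → Type v} [∀ i, MulAction G (E i)] [∀ i, Fintype (E i)] [Fintype I] [∀ i, Nonempty (E i)]

/-- **THE DEFECT IS `dim(⟨b⟩ ∩ ⟨b′⟩) · dim A` (type ranks)**: in the setting of file I10,
`rank Φ₀ + rank Φ₁ = rank(Φ₀,Φ₁) + 1 + dim(span{b_j} ∩ span{b′_k}) · dim A`.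
[cite: Gordon1999HodgeAVSurvey, §3 Theorem, 7.5–7.7 and 9.4.3] [cite: Lang2002, XVII §3] -/
theorem typeRank_add_typeRank_eq_add_finrank_inf_mul_of_class {ρ : G} {Φ : ∀ i, Set (E i)}
    (h : ∀ i, IsCMTypeWith ρ (Φ i)) {i₀ i₁ : I} (hI : ∀ j, j = i₀ ∨ j = i₁) (h01 : i₀ ≠ i₁)
    (r₀ : E i₀ → Y₀) (r₁ : E i₁ → Y₁) (hr₀ : ∀ (g : G) (x : E i₀), r₀ (g • x) = g • r₀ x)
    (hr₁ : ∀ (g : G) (x : E i₁), r₁ (g • x) = g • r₁ x)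
    (hfine₀ : ∀ x x' : E i₀, r₀ x = r₀ x' → ∃ n : G, (∀ y : E i₁, n • y = y) ∧ n • x = x')
    (hfine₁ : ∀ x x' : E i₁, r₁ x = r₁ x' → ∃ n : G, (∀ y : E i₀, n • y = y) ∧ n • x = x')
    {A : Submodule ℚ (Y → ℚ)}
    (hAst : ∀ (k : G) (a : Y → ℚ), a ∈ A → (fun y => a (k • y)) ∈ A)
    (hAirr : ∀ W : Submodule ℚ (Y → ℚ), W ≤ A → W ≠ ⊥ →
      (∀ (k : G) (f : Y → ℚ), f ∈ W → (fun y => f (k • y)) ∈ W) → W = A)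
    (hsc : ∀ L : (Y → ℚ) →ₗ[ℚ] (Y → ℚ), (∀ a ∈ A, L a ∈ A) →
      (∀ (k : G) (a : Y → ℚ), a ∈ A → L (fun y => a (k • y)) = fun y => L a (k • y)) → ∃ c : ℚ, ∀ a ∈ A, L a = c • a)
    {J₀ : Type u₀} {J₁ : Type u₁} [Fintype J₀] [Fintype J₁]
    (ι₀ : J₀ → ((Y → ℚ) →ₗ[ℚ] (Y₀ → ℚ))) (ι₁ : J₁ → ((Y → ℚ) →ₗ[ℚ] (Y₁ → ℚ)))
    (hι₀eq : ∀ (j : J₀) (k : G) (a : Y → ℚ), a ∈ A → ι₀ j (fun y => a (k • y)) = fun y => ι₀ j a (k • y))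
    (hι₁eq : ∀ (j : J₁) (k : G) (a : Y → ℚ), a ∈ A → ι₁ j (fun y => a (k • y)) = fun y => ι₁ j a (k • y))
    (hind₀ : ∀ f : J₀ → (Y → ℚ), (∀ j, f j ∈ A) → ∑ j, ι₀ j (f j) = 0 → ∀ j, f j = 0)
    (hind₁ : ∀ f : J₁ → (Y → ℚ), (∀ j, f j ∈ A) → ∑ j, ι₁ j (f j) = 0 → ∀ j, f j = 0)
    {b₀ : J₀ → (Y → ℚ)} {b₁ : J₁ → (Y → ℚ)} (hb₀ : ∀ j, b₀ j ∈ A) (hb₁ : ∀ j, b₁ j ∈ A)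
    (hw₀ : (fun y : Y₀ => ∑ x ∈ Finset.univ.filter (fun x => r₀ x = y), antiVec (Φ i₀) (1 : G) x) =
      ∑ j, ι₀ j (b₀ j))
    (hw₁ : (fun y : Y₁ => ∑ x ∈ Finset.univ.filter (fun x => r₁ x = y), antiVec (Φ i₁) (1 : G) x) =
      ∑ j, ι₁ j (b₁ j)) :
    typeRank G (Φ i₀) + typeRank G (Φ i₁) = typeRank G (sigmaType Φ) + 1 +
      Module.finrank ℚ ↥(Submodule.span ℚ (Set.range b₀) ⊓ Submodule.span ℚ (Set.range b₁)) *
        Module.finrank ℚ A := by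
  have hcls := typeRank_add_typeRank_add_rank_mul_eq_of_class h hI h01 r₀ r₁ hr₀ hr₁ hfine₀ hfine₁ hAst hAirr hsc
    ι₀ ι₁ hι₀eq hι₁eq hind₀ hind₁ hb₀ hb₁ hw₀ hw₁
  have hgr := finrank_span_range_sum_elim_add_finrank_inf b₀ b₁
  have hmul : (Module.finrank ℚ ↥(Submodule.span ℚ (Set.range b₀)) +
      Module.finrank ℚ ↥(Submodule.span ℚ (Set.range b₁))) * Module.finrank ℚ A =
      Module.finrank ℚ ↥(Submodule.span ℚ (Set.range (Sum.elim b₀ b₁))) * Module.finrank ℚ A +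
        Module.finrank ℚ ↥(Submodule.span ℚ (Set.range b₀) ⊓ Submodule.span ℚ (Set.range b₁)) *
          Module.finrank ℚ A := by
    rw [← hgr, add_mul]
  omega

/-- **ADDITIVITY IFF THE SPANS MEET TRIVIALLY (type ranks)**: for `A ≠ 0`,
`rank Φ₀ + rank Φ₁ = rank(Φ₀,Φ₁) + 1 ⟺ span{b_j} ∩ span{b′_k} = 0`. [cite: Gordon1999HodgeAVSurvey, §3 Theorem,
7.5–7.7 and 9.4.3] [cite: Lang2002, XVII §3] -/
theorem typeRank_add_typeRank_eq_iff_of_class {ρ : G} {Φ : ∀ i, Set (E i)}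
    (h : ∀ i, IsCMTypeWith ρ (Φ i)) {i₀ i₁ : I} (hI : ∀ j, j = i₀ ∨ j = i₁) (h01 : i₀ ≠ i₁)
    (r₀ : E i₀ → Y₀) (r₁ : E i₁ → Y₁) (hr₀ : ∀ (g : G) (x : E i₀), r₀ (g • x) = g • r₀ x)
    (hr₁ : ∀ (g : G) (x : E i₁), r₁ (g • x) = g • r₁ x)
    (hfine₀ : ∀ x x' : E i₀, r₀ x = r₀ x' → ∃ n : G, (∀ y : E i₁, n • y = y) ∧ n • x = x')
    (hfine₁ : ∀ x x' : E i₁, r₁ x = r₁ x' → ∃ n : G, (∀ y : E i₀, n • y = y) ∧ n • x = x')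
    {A : Submodule ℚ (Y → ℚ)}
    (hAst : ∀ (k : G) (a : Y → ℚ), a ∈ A → (fun y => a (k • y)) ∈ A)
    (hAirr : ∀ W : Submodule ℚ (Y → ℚ), W ≤ A → W ≠ ⊥ →
      (∀ (k : G) (f : Y → ℚ), f ∈ W → (fun y => f (k • y)) ∈ W) → W = A)
    (hsc : ∀ L : (Y → ℚ) →ₗ[ℚ] (Y → ℚ), (∀ a ∈ A, L a ∈ A) →
      (∀ (k : G) (a : Y → ℚ), a ∈ A → L (fun y => a (k • y)) = fun y => L a (k • y)) → ∃ c : ℚ, ∀ a ∈ A, L a = c • a)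
    (hA0 : A ≠ ⊥) {J₀ : Type u₀} {J₁ : Type u₁} [Fintype J₀] [Fintype J₁]
    (ι₀ : J₀ → ((Y → ℚ) →ₗ[ℚ] (Y₀ → ℚ))) (ι₁ : J₁ → ((Y → ℚ) →ₗ[ℚ] (Y₁ → ℚ)))
    (hι₀eq : ∀ (j : J₀) (k : G) (a : Y → ℚ), a ∈ A → ι₀ j (fun y => a (k • y)) = fun y => ι₀ j a (k • y))
    (hι₁eq : ∀ (j : J₁) (k : G) (a : Y → ℚ), a ∈ A → ι₁ j (fun y => a (k • y)) = fun y => ι₁ j a (k • y))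
    (hind₀ : ∀ f : J₀ → (Y → ℚ), (∀ j, f j ∈ A) → ∑ j, ι₀ j (f j) = 0 → ∀ j, f j = 0)
    (hind₁ : ∀ f : J₁ → (Y → ℚ), (∀ j, f j ∈ A) → ∑ j, ι₁ j (f j) = 0 → ∀ j, f j = 0)
    {b₀ : J₀ → (Y → ℚ)} {b₁ : J₁ → (Y → ℚ)} (hb₀ : ∀ j, b₀ j ∈ A) (hb₁ : ∀ j, b₁ j ∈ A)
    (hw₀ : (fun y : Y₀ => ∑ x ∈ Finset.univ.filter (fun x => r₀ x = y), antiVec (Φ i₀) (1 : G) x) =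
      ∑ j, ι₀ j (b₀ j))
    (hw₁ : (fun y : Y₁ => ∑ x ∈ Finset.univ.filter (fun x => r₁ x = y), antiVec (Φ i₁) (1 : G) x) =
      ∑ j, ι₁ j (b₁ j)) :
    typeRank G (Φ i₀) + typeRank G (Φ i₁) = typeRank G (sigmaType Φ) + 1 ↔
      Submodule.span ℚ (Set.range b₀) ⊓ Submodule.span ℚ (Set.range b₁) = ⊥ := by
  have hf := typeRank_add_typeRank_eq_add_finrank_inf_mul_of_class h hI h01 r₀ r₁ hr₀ hr₁ hfine₀ hfine₁ hAst hAirr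
    hsc ι₀ ι₁ hι₀eq hι₁eq hind₀ hind₁ hb₀ hb₁ hw₀ hw₁
  haveI : FiniteDimensional ℚ A := Submodule.finiteDimensional_of_le le_top
  have hA : Module.finrank ℚ A ≠ 0 := fun h0 => hA0 (Submodule.finrank_eq_zero.1 h0)
  rw [← Submodule.finrank_eq_zero]
  constructor
  · intro heq
    rw [heq] at hf
    have h0 : Module.finrank ℚ ↥(Submodule.span ℚ (Set.range b₀) ⊓ Submodule.span ℚ (Set.range b₁)) *
        Module.finrank ℚ A = 0 := by omega
    rcases mul_eq_zero.1 h0 with h1 | h1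
    · exact h1
    · exact absurd h1 hA
  · intro h0
    rw [h0, zero_mul, add_zero] at hf
    exact hf

end TypeRanks

end Summit.HodgeConjecture.CorCM.IrrOdd

/-! ### §4 CM fields -/

namespace Summit.HodgeConjecture.CorCM

open CategoryTheory CategoryTheory.Limits NumberField Module IntermediateField
open Literature.NumberTheory.ComplexMultiplication
open Literature.AlgebraicGeometry.Motives (AbelianVariety CMType)
open Literature.AlgebraicGeometry.Motives.AbelianVariety
open Literature.AlgebraicGeometry.HodgeTheory
open Literature.AlgebraicGeometry.ComplexMultiplication (IsCMTypeRealisation)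
open Literature.AlgebraicGeometry.Pohlmann1968

variable {I : Type} [Fintype I] {K : I → Type} [∀ i, Field (K i)] [∀ i, NumberField (K i)] [∀ i, IsCMField (K i)]
  {T₀ : Type} [Field T₀] [NumberField T₀] {T₁ : Type} [Field T₁] [NumberField T₁]
  {Y : Type vY} [MulAction (ℂ ≃+* ℂ) Y] [Fintype Y]

/-- **THE DEFECT IS `dim(⟨b⟩ ∩ ⟨b′⟩) · dim A` (CM fields)**: in the setting of file I10 (subfields `T_κ ⊆ K_{i_κ}` with
(TR); both shadows assembled from a reference `Aut(ℂ)`-stable irreducible `A` with scalar commutant by jointly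
independent equivariant embeddings; components `b_j`, `b′_k ∈ A`)
**`cmTypeRank Φ₀ + cmTypeRank Φ₁ = cmFamilyRank Φ + 1 + dim(span_ℚ{b_j} ∩ span_ℚ{b′_k}) · dim A`** — the defect
`dim Hg(A₀)+dim Hg(A₁)−dim Hg(A₀×A₁)` counts the copies of `A` in which the ℚ-spans of the two component tuples meet.
[cite: Gordon1999HodgeAVSurvey, §3 Theorem, 7.5–7.7 and 9.4.3] [cite: Lang2002, XVII §3] [cite: Serre1977, §2.6] -/
theorem cmTypeRank_add_cmTypeRank_eq_add_finrank_inf_mul_of_class {i₀ i₁ : I} (h01 : i₀ ≠ i₁)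
    (hI : ∀ l, l = i₀ ∨ l = i₁) (Φ : ∀ i, CMType (K i)) [Algebra T₀ (K i₀)] [Algebra T₁ (K i₁)]
    (htr₀ : ∀ (a : K i₀ →+* ℂ) (k : K i₀), a k ∈ normalClosure ℚ (K i₁) ℂ → k ∈ Set.range (algebraMap T₀ (K i₀)))
    (htr₁ : ∀ (b : K i₁ →+* ℂ) (k : K i₁), b k ∈ normalClosure ℚ (K i₀) ℂ → k ∈ Set.range (algebraMap T₁ (K i₁)))
    {A : Submodule ℚ (Y → ℚ)}
    (hAst : ∀ (k : ℂ ≃+* ℂ) (a : Y → ℚ), a ∈ A → (fun y => a (k • y)) ∈ A)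
    (hAirr : ∀ W : Submodule ℚ (Y → ℚ), W ≤ A → W ≠ ⊥ →
      (∀ (k : ℂ ≃+* ℂ) (f : Y → ℚ), f ∈ W → (fun y => f (k • y)) ∈ W) → W = A)
    (hsc : ∀ L : (Y → ℚ) →ₗ[ℚ] (Y → ℚ), (∀ a ∈ A, L a ∈ A) →
      (∀ (k : ℂ ≃+* ℂ) (a : Y → ℚ), a ∈ A → L (fun y => a (k • y)) = fun y => L a (k • y)) →
        ∃ c : ℚ, ∀ a ∈ A, L a = c • a)
    {J₀ J₁ : Type} [Fintype J₀] [Fintype J₁]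
    (ι₀ : J₀ → ((Y → ℚ) →ₗ[ℚ] ((T₀ →+* ℂ) → ℚ))) (ι₁ : J₁ → ((Y → ℚ) →ₗ[ℚ] ((T₁ →+* ℂ) → ℚ)))
    (hι₀eq : ∀ (j : J₀) (k : ℂ ≃+* ℂ) (a : Y → ℚ), a ∈ A → ι₀ j (fun y => a (k • y)) = fun y => ι₀ j a (k • y))
    (hι₁eq : ∀ (j : J₁) (k : ℂ ≃+* ℂ) (a : Y → ℚ), a ∈ A → ι₁ j (fun y => a (k • y)) = fun y => ι₁ j a (k • y))
    (hind₀ : ∀ f : J₀ → (Y → ℚ), (∀ j, f j ∈ A) → ∑ j, ι₀ j (f j) = 0 → ∀ j, f j = 0)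
    (hind₁ : ∀ f : J₁ → (Y → ℚ), (∀ j, f j ∈ A) → ∑ j, ι₁ j (f j) = 0 → ∀ j, f j = 0)
    {b₀ : J₀ → (Y → ℚ)} {b₁ : J₁ → (Y → ℚ)} (hb₀ : ∀ j, b₀ j ∈ A) (hb₁ : ∀ j, b₁ j ∈ A)
    (hw₀ : (fun y : T₀ →+* ℂ => ∑ t ∈ Finset.univ.filter (fun t : K i₀ →+* ℂ => t.comp (algebraMap T₀ (K i₀)) = y),
        antiVec (Φ i₀).1 (1 : ℂ ≃+* ℂ) t) = ∑ j, ι₀ j (b₀ j))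
    (hw₁ : (fun y : T₁ →+* ℂ => ∑ t ∈ Finset.univ.filter (fun t : K i₁ →+* ℂ => t.comp (algebraMap T₁ (K i₁)) = y),
        antiVec (Φ i₁).1 (1 : ℂ ≃+* ℂ) t) = ∑ j, ι₁ j (b₁ j)) :
    cmTypeRank (Φ i₀) + cmTypeRank (Φ i₁) = CMAlgebra.cmFamilyRank Φ + 1 +
      Module.finrank ℚ ↥(Submodule.span ℚ (Set.range b₀) ⊓ Submodule.span ℚ (Set.range b₁)) *
        Module.finrank ℚ A := by
  haveI : ∀ i, Nonempty (K i →+* ℂ) := fun i => inferInstance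
  exact IrrOdd.typeRank_add_typeRank_eq_add_finrank_inf_mul_of_class (G := ℂ ≃+* ℂ) (E := fun i => K i →+* ℂ)
    (Φ := fun i => (Φ i).1) (fun i => isCMTypeWith_conj (Φ i)) hI h01
    (fun t : K i₀ →+* ℂ => t.comp (algebraMap T₀ (K i₀))) (fun t : K i₁ →+* ℂ => t.comp (algebraMap T₁ (K i₁)))
    (fun _ _ => rfl) (fun _ _ => rfl) (exists_stab_smul_eq_of_comp_eq_of_trace_le i₁ htr₀)
    (exists_stab_smul_eq_of_comp_eq_of_trace_le i₀ htr₁) hAst hAirr hsc ι₀ ι₁ hι₀eq hι₁eq hind₀ hind₁ hb₀ hb₁ hw₀ hw₁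

/-- **ADDITIVITY IFF THE SPANS MEET TRIVIALLY (CM fields)**: in the same setting with `A ≠ 0`,
**`cmTypeRank Φ₀ + cmTypeRank Φ₁ = cmFamilyRank Φ + 1` (i.e. `Hg(A₀×A₁) = Hg(A₀)×Hg(A₁)`)
`⟺ span_ℚ{b_j} ∩ span_ℚ{b′_k} = 0`**.
[cite: Gordon1999HodgeAVSurvey, §3 Theorem, 7.5–7.7 and 9.4.3] [cite: Lang2002, XVII §3] [cite: Serre1977, §2.6] -/
theorem cmTypeRank_add_cmTypeRank_eq_iff_of_class {i₀ i₁ : I} (h01 : i₀ ≠ i₁)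
    (hI : ∀ l, l = i₀ ∨ l = i₁) (Φ : ∀ i, CMType (K i)) [Algebra T₀ (K i₀)] [Algebra T₁ (K i₁)]
    (htr₀ : ∀ (a : K i₀ →+* ℂ) (k : K i₀), a k ∈ normalClosure ℚ (K i₁) ℂ → k ∈ Set.range (algebraMap T₀ (K i₀)))
    (htr₁ : ∀ (b : K i₁ →+* ℂ) (k : K i₁), b k ∈ normalClosure ℚ (K i₀) ℂ → k ∈ Set.range (algebraMap T₁ (K i₁)))
    {A : Submodule ℚ (Y → ℚ)}
    (hAst : ∀ (k : ℂ ≃+* ℂ) (a : Y → ℚ), a ∈ A → (fun y => a (k • y)) ∈ A)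
    (hAirr : ∀ W : Submodule ℚ (Y → ℚ), W ≤ A → W ≠ ⊥ →
      (∀ (k : ℂ ≃+* ℂ) (f : Y → ℚ), f ∈ W → (fun y => f (k • y)) ∈ W) → W = A)
    (hsc : ∀ L : (Y → ℚ) →ₗ[ℚ] (Y → ℚ), (∀ a ∈ A, L a ∈ A) →
      (∀ (k : ℂ ≃+* ℂ) (a : Y → ℚ), a ∈ A → L (fun y => a (k • y)) = fun y => L a (k • y)) →
        ∃ c : ℚ, ∀ a ∈ A, L a = c • a)
    (hA0 : A ≠ ⊥) {J₀ J₁ : Type} [Fintype J₀] [Fintype J₁]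
    (ι₀ : J₀ → ((Y → ℚ) →ₗ[ℚ] ((T₀ →+* ℂ) → ℚ))) (ι₁ : J₁ → ((Y → ℚ) →ₗ[ℚ] ((T₁ →+* ℂ) → ℚ)))
    (hι₀eq : ∀ (j : J₀) (k : ℂ ≃+* ℂ) (a : Y → ℚ), a ∈ A → ι₀ j (fun y => a (k • y)) = fun y => ι₀ j a (k • y))
    (hι₁eq : ∀ (j : J₁) (k : ℂ ≃+* ℂ) (a : Y → ℚ), a ∈ A → ι₁ j (fun y => a (k • y)) = fun y => ι₁ j a (k • y))
    (hind₀ : ∀ f : J₀ → (Y → ℚ), (∀ j, f j ∈ A) → ∑ j, ι₀ j (f j) = 0 → ∀ j, f j = 0)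
    (hind₁ : ∀ f : J₁ → (Y → ℚ), (∀ j, f j ∈ A) → ∑ j, ι₁ j (f j) = 0 → ∀ j, f j = 0)
    {b₀ : J₀ → (Y → ℚ)} {b₁ : J₁ → (Y → ℚ)} (hb₀ : ∀ j, b₀ j ∈ A) (hb₁ : ∀ j, b₁ j ∈ A)
    (hw₀ : (fun y : T₀ →+* ℂ => ∑ t ∈ Finset.univ.filter (fun t : K i₀ →+* ℂ => t.comp (algebraMap T₀ (K i₀)) = y),
        antiVec (Φ i₀).1 (1 : ℂ ≃+* ℂ) t) = ∑ j, ι₀ j (b₀ j))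
    (hw₁ : (fun y : T₁ →+* ℂ => ∑ t ∈ Finset.univ.filter (fun t : K i₁ →+* ℂ => t.comp (algebraMap T₁ (K i₁)) = y),
        antiVec (Φ i₁).1 (1 : ℂ ≃+* ℂ) t) = ∑ j, ι₁ j (b₁ j)) :
    cmTypeRank (Φ i₀) + cmTypeRank (Φ i₁) = CMAlgebra.cmFamilyRank Φ + 1 ↔
      Submodule.span ℚ (Set.range b₀) ⊓ Submodule.span ℚ (Set.range b₁) = ⊥ := by
  haveI : ∀ i, Nonempty (K i →+* ℂ) := fun i => inferInstance
  exact IrrOdd.typeRank_add_typeRank_eq_iff_of_class (G := ℂ ≃+* ℂ) (E := fun i => K i →+* ℂ)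
    (Φ := fun i => (Φ i).1) (fun i => isCMTypeWith_conj (Φ i)) hI h01
    (fun t : K i₀ →+* ℂ => t.comp (algebraMap T₀ (K i₀))) (fun t : K i₁ →+* ℂ => t.comp (algebraMap T₁ (K i₁)))
    (fun _ _ => rfl) (fun _ _ => rfl) (exists_stab_smul_eq_of_comp_eq_of_trace_le i₁ htr₀)
    (exists_stab_smul_eq_of_comp_eq_of_trace_le i₀ htr₁) hAst hAirr hsc hA0 ι₀ ι₁ hι₀eq hι₁eq hind₀ hind₁ hb₀ hb₁
    hw₀ hw₁

end Summit.HodgeConjecture.CorCM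

end
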